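import Summits.QuantumFields.BalabanUV.T4Continuum.Spine.NE2.ComposedRemainderLoopRate
import Summits.QuantumFields.BalabanUV.T4Continuum.Spine.NE2.AdjointFieldInstance
import Summits.QuantumFields.BalabanUV.T4Continuum.Spine.NE2.AdjointFrameLieClosure

/-!
# T⁴ programme, spine node NE2 (U1a) — R14 W3c, file 7: THE END FOR TOWERS OF UNITARY GAUGE FIELDS READ THROUGH `Ad` — every hypothesis about the ADJOINT data tower and about (124)'s
# coefficients DISCHARGED from letters on the FUNDAMENTAL fields (cell `pub-balaban-gaps`, seat ne2 gen 6)

`ComposedRemainderLoopRate.composed_full_averaging_rate_of_loops` (file 4) still displays the ADJOINT data tower `W` of each problem with its letters (`hWn`, `hWa`, `hWc`, `hWd`, `hRd`), the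
main-table sizes `σ₁` (`hS`) and the composed-table cross letter `θ` (`hT`) next to the fundamental towers `U`.  In print both are ONE object: the averaging transports with
`R(U) = Ad U` ([B9] (3.3) p.390, (3.19) p.393) of the (averaged) gauge field.  THIS FILE takes towers of UNITARY bond variables `U k i ν b ∈ U(N)` as the only field data, sets
**`adT hF U`** `i ν b := adRep hF (U i ν b)` (`AdjointFieldInstance.adRep`, the β cell's complexified adjoint representation in a component family `hF : CompFamily c P e`) and
**`fundT U`** (the same bond variables as matrices), and derives: `‖Ad‖ ≤ 1`, `‖Ad U − 1‖ ≤ 2‖U − 1‖` (`norm_adRep_sub_one_le`), `‖Ad U − Ad U′‖ ≤ 2‖U − U′‖`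
(`norm_adRep_sub_adRep_le`), the main-table size `σ₁ = (1 + 2α_U/L^{i+1})^{(d+1)L} − 1` (`ComposedFullAveragingRate.norm_Smain_sub_one_le`) and the composed-table letter
`θ k = consBal d L (2c_U(k,·)) k` (`CovariantTableBalabanTwoLevel.norm_prefix_sub_prefix_le`).  **`composed_full_averaging_rate_of_gaugeTowers`**: the (3.26)-shape END with print's composed
averaging + (124)'s remainders at every step, for problems `k ↦ (U k i)_i` given ONLY by: sizes `‖U − 1‖ ≤ α_U/L^i`, NE3-type closeness `‖U^{(k+1)} − U^{(k)}‖ ≤ σ_Uθ_c^k/L^i` (`i ≤ k`) and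
`≤ c_U(k,i)`, commutator-form plaquette letters `p` with `d·L²·p ≤ 1/16`, the loop logarithms in the frame's carrier `P` (automatic for log-charted structure groups, file 4), the Lie
(no separate Lie-closure hypothesis), node NE3's `LocalRate` BY NAME, the tier-B data `R`, `P₄`, and the real inequalities `hΓ`, `hE`, `hrate`, `hsmall` on the resulting letters.  The Lie closure `hPad` of the frame's carrier `P` (a hypothesis of
`OneStepRemainderAdjoint`'s letters) is DERIVED here from `CompFamily.stable` (Ad-invariance) by differentiating `t ↦ Ad(e^{itY})X` at `0` in the closed subspace `P` (`AdjointFrameLieClosure.lie_mem_of_stable`).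
REMAINS (located, unchanged): the letters themselves for Bałaban's minimiser and its [B7] (15) averages — `U k i` = the `(k−i)`-fold average of `U k k` is NOT constructed here (DIVERGENCE
F6 (ζ)), so the coherence «`W i` = `Ad` of the average of `W (i+1)`» behind `R̄_{0,c}` stays a property of the DATA —, G2 = NE3, (W2″), (R7).
HONEST FRAMING (T4-DAG p. 1).  A COMPOSITION of kernel theorems about MODEL objects; `U`, `R`, `P₄`, the frame are DATA asserted by nobody; NE3 OPEN by name; nothing of Bałaban's asserted
beyond the displayed readings; NOT an instance of Bałaban's minimiser or of (3.35); NOT NE2, NOT [B9] (3.16)/(3.26) as printed; **NE2 (U1a) NOT PROVED**; spine PROVED 0/9 unchanged; NOT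
continuum YM / infinite volume / mass gap / Clay.  HONEST DEPENDENCY: continuum YM on T⁴ ⇐ BetaPertH ∧ nine spine estimates (0/9 proved); BetaPertH ⇐ (D1) ∧ (D4) ∧ CAP+tail.  No `sorry`.
-/

noncomputable section

open scoped BigOperators ComplexConjugate Matrix Matrix.Norms.L2Operator Kronecker
open Finset (range)

namespace Summit.QuantumFields.BalabanUV.T4Continuum.NE2.ComposedRemainderGaugeTower

open Literature.MathematicalPhysics.QuantumFieldTheory.Balaban1983to89.B5Prop11Plancherel (Tor fine unitVec Cst)
open Literature.MathematicalPhysics.QuantumFieldTheory.Balaban1983to89.B5G183RateUnitTower (lev lev_neZero)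
open Literature.MathematicalPhysics.QuantumFieldTheory.Balaban1983to89.T4EtaRateMin (LocalRate)
open Literature.MathematicalPhysics.QuantumFieldTheory.Balaban1983to89.B9AdOrthogonal (form)
open Summit.QuantumFields.BalabanUV.Beta.AdjointCarrierWiringEnd (CompFamily)
open Summit.QuantumFields.BalabanUV.T4Continuum
open Summit.QuantumFields.BalabanUV.T4Continuum.BalabanAveragedTowerUnit (idx Qlev)
open Summit.QuantumFields.BalabanUV.T4Continuum.KingPairingPlantedLaw (JpcT calDalev CJ)
open Summit.QuantumFields.BalabanUV.T4Continuum.GramPerturbationLaw (C2gram)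
open Summit.QuantumFields.BalabanUV.T4Continuum.CovariantAveragingTower (TowerLimitRate)
open Summit.QuantumFields.BalabanUV.T4Continuum.BackgroundResolventTower (PerturbationLaws Cpert)
open Summit.QuantumFields.BalabanUV.T4Continuum.RegularBackgroundTower (RegularTransporters regClass)
open Summit.QuantumFields.BalabanUV.T4Continuum.NE2FromNE3 (bgReadings)
open Summit.QuantumFields.BalabanUV.T4Continuum.CovariantAveragingSummand (kappaQ)
open Summit.QuantumFields.BalabanUV.T4Continuum.NE2BalabanLayer (tierBPert kappaB C2B)
open Summit.QuantumFields.BalabanUV.T4Continuum.NE2.CovariantTableBalaban (TBal)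
open Summit.QuantumFields.BalabanUV.T4Continuum.NE2.CovariantTableBalabanTwoLevel (consBal consBal_nonneg norm_prefix_sub_prefix_le)
open Summit.QuantumFields.BalabanUV.T4Continuum.NE2.ComposedAveragingMean (thetaZero)
open Summit.QuantumFields.BalabanUV.T4Continuum.NE2.ComposedAveragingRemainder (avgPertFull)
open Summit.QuantumFields.BalabanUV.T4Continuum.NE2.OneStepRemainder (Smain)
open Summit.QuantumFields.BalabanUV.T4Continuum.NE2.ComposedRemainderTower (RemCoeff Erem cR)
open Summit.QuantumFields.BalabanUV.T4Continuum.NE2.ComposedRemainderTwoLevel (sameBnd crossBnd DeltaStep epsStep)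
open Summit.QuantumFields.BalabanUV.T4Continuum.NE2.ComposedFullAveragingRate (norm_Smain_sub_one_le)
open Summit.QuantumFields.BalabanUV.T4Continuum.NE2.OneStepRemainderLoopCoeff (YxT remCoeffOf)
open Summit.QuantumFields.BalabanUV.T4Continuum.NE2.ComposedRemainderLoopRate (composed_full_averaging_rate_of_loops)
open Summit.QuantumFields.BalabanUV.T4Continuum.NE2.AdjointFieldInstance (adRep norm_adRep_le_one norm_adRep_sub_one_le norm_adRep_sub_adRep_le dist1_unitaryGroup)
open Summit.QuantumFields.BalabanUV.T4Continuum.NE2.AdjointFrameLieClosure (lie_mem_of_stable)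

variable {d : ℕ} (L : ℕ) [NeZero L] (M : Fin d → ℕ) [hM : ∀ μ, NeZero (M μ)]
  {n : Type} [Fintype n] [DecidableEq n] {ι : Type} [Fintype ι] [DecidableEq ι] {c : ℝ} {P : Submodule ℝ (Matrix n n ℂ)} {e : ι → Matrix n n ℂ}

/-! ## §1 The two readings of a tower of unitary bond variables -/

/-- the FUNDAMENTAL reading: the bond variables as `n×n` matrices. [folklore] -/
def fundT (U : (i : ℕ) → Fin d → (idx L M i → Matrix.unitaryGroup n ℂ)) : (i : ℕ) → Fin d → (idx L M i → Matrix n n ℂ) := fun i ν b => (U i ν b : Matrix n n ℂ)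

/-- **THE ADJOINT READING `R(U) = Ad U`** in the component family `hF` — the transporters of [B9] (3.3)/(3.19) acting on Lie-algebra-valued fields. [cite: Balaban1985BackgroundPropagators, (3.3) p.390, (3.19) p.393 (shape)] [folklore] -/
def adT (hF : CompFamily c P e) (U : (i : ℕ) → Fin d → (idx L M i → Matrix.unitaryGroup n ℂ)) : (i : ℕ) → Fin d → (idx L M i → Matrix ι ι ℂ) := fun i ν b => adRep hF (U i ν b)

variable (hF : CompFamily c P e)

omit [NeZero L] hM in
/-- the fundamental reading is unitary. [folklore] -/
theorem fundT_mem (U : (i : ℕ) → Fin d → (idx L M i → Matrix.unitaryGroup n ℂ)) (i : ℕ) (ν : Fin d) (b : idx L M i) : fundT L M U i ν b ∈ Matrix.unitaryGroup n ℂ := (U i ν b).2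

omit [NeZero L] hM in
/-- `‖Ad U‖ ≤ 1`. [folklore] -/
theorem norm_adT_le_one (U : (i : ℕ) → Fin d → (idx L M i → Matrix.unitaryGroup n ℂ)) (i : ℕ) (ν : Fin d) (b : idx L M i) : ‖adT L M hF U i ν b‖ ≤ 1 := norm_adRep_le_one hF _

omit [NeZero L] hM in
/-- `‖Ad U − 1‖ ≤ 2‖U − 1‖`. [folklore] -/
theorem norm_adT_sub_one_le [Nonempty n] (U : (i : ℕ) → Fin d → (idx L M i → Matrix.unitaryGroup n ℂ)) {a : ℝ} (i : ℕ) (ν : Fin d) (b : idx L M i) (h : ‖(U i ν b : Matrix n n ℂ) - 1‖ ≤ a) :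
    ‖adT L M hF U i ν b - 1‖ ≤ 2 * a :=
  (norm_adRep_sub_one_le hF _).trans (by rw [dist1_unitaryGroup]; linarith)

omit [NeZero L] hM in
/-- `‖Ad U − Ad U′‖ ≤ 2‖U − U′‖`. [folklore] -/
theorem norm_adT_sub_adT_le [Nonempty n] (U U' : (i : ℕ) → Fin d → (idx L M i → Matrix.unitaryGroup n ℂ)) {a : ℝ} (i : ℕ) (ν : Fin d) (b : idx L M i)
    (h : ‖(U i ν b : Matrix n n ℂ) - (U' i ν b : Matrix n n ℂ)‖ ≤ a) : ‖adT L M hF U i ν b - adT L M hF U' i ν b‖ ≤ 2 * a :=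
  (norm_adRep_sub_adRep_le hF _ _).trans (by linarith)

/-! ## §2 The END for towers of unitary gauge fields -/

variable (a : ℝ) (ha : 0 < a) [Nonempty n] [Nonempty ι]

/-- **THE (3.26)-SHAPE END WITH THE FULL LINEARISED COMPOSED AVERAGING FOR TOWERS OF UNITARY GAUGE FIELDS READ THROUGH `Ad`**: file 4's `composed_full_averaging_rate_of_loops` with
`W k := adT hF (U k)` (the adjoint tower) and the fundamental tower `fundT (U k)`; the hypotheses `hWn/hWa/hWc/hWd/hRd` (adjoint letters), `hS` (main-table sizes) and `hT` (composed-table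
closeness) are PROVED from the fundamental letters `hUa`, `hUc`, `hUd` (`α := 2α_U`, `σ := 2σ_U`, `σ₁ k i := (1 + 2α_U/L^{i+1})^{(d+1)L} − 1`, `cW k i := 2c_U(k,i+1)`, `δR k i := 2c_U(k,i)`,
`θ k := consBal d L (2c_U(k,·)) k`).  Displayed: unitarity is in the type; sizes, closeness, plaquette letters, `Y_x ∈ P`, the frame `hF` (its Lie closure derived by `lie_mem_of_stable`), `hreg`/`hNE3`/`hP₄`, and the real inequalities.
[cite: Balaban1985BackgroundPropagators, (3.3) p.390, (3.15)–(3.16) p.393, (3.26) p.395; Balaban1985Averaging, (114) p.34, (124)–(126) p.36, (139)–(143) p.39; King1986, Lemma 4.5 (4.38) p.674 (method)] [folklore] -/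
theorem composed_full_averaging_rate_of_gaugeTowers (hL : 2 ≤ L) (hd : 1 ≤ d) {R : (k : ℕ) → Fin d → (idx L M k → Matrix ι ι ℂ)} {αR βR : ℝ}
    (hreg : RegularTransporters L M R αR βR) {C : ℝ} (hC : 0 ≤ C) (hNE3 : LocalRate (bgReadings L M (regClass L M R)) C ((L : ℝ)⁻¹))
    {U : ℕ → (i : ℕ) → Fin d → (idx L M i → Matrix.unitaryGroup n ℂ)} {αU σU θc ρ : ℝ}
    (hαU : 0 ≤ αU) (hσU : 0 ≤ σU) (hθ0 : 0 ≤ θc) (hθ1 : θc ≤ 1) (hθρ : θc ≤ ρ) (hρ : 3 / (2 * (L : ℝ)) ≤ ρ) (hρ1 : ρ < 1)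
    (hUa : ∀ k i ν b, ‖(U k i ν b : Matrix n n ℂ) - 1‖ ≤ αU / (lev L i : ℕ))
    (hUc : ∀ k i ν b, i ≤ k → ‖(U (k + 1) i ν b : Matrix n n ℂ) - (U k i ν b : Matrix n n ℂ)‖ ≤ σU * θc ^ k / (lev L i : ℕ))
    {p : ℕ → ℕ → ℝ} (hp0 : ∀ k i, 0 ≤ p k i)
    (hp : ∀ k i (x : Tor (fine (L * lev L i) M)) (ν μ : Fin d),
      ‖fundT L M (U k) (i + 1) ν (x, μ) * fundT L M (U k) (i + 1) μ (x + unitVec (fine (L * lev L i) M) ν, μ) - fundT L M (U k) (i + 1) μ (x, μ) * fundT L M (U k) (i + 1) ν (x + unitVec (fine (L * lev L i) M) μ, μ)‖ ≤ p k (i + 1))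
    (hpL : ∀ k i, d * (L : ℝ) ^ 2 * p k (i + 1) ≤ 1 / 16) (hYP : ∀ k i x μ r, YxT L M (fundT L M (U k)) i x μ r ∈ P)
    {cU : ℕ → ℕ → ℝ} {Γ E Cr : ℝ} (hcU0 : ∀ k i, 0 ≤ cU k i) (hUd : ∀ k i ν b, ‖(U (k + 1) i ν b : Matrix n n ℂ) - (U k i ν b : Matrix n n ℂ)‖ ≤ cU k i)
    (hΓ : ∀ k k', ∑ i ∈ range k', (64 * (d * (L : ℝ) ^ 2 * p k (i + 1))) ≤ Γ) (hE : ∀ k k', ∑ i ∈ range k', (Fintype.card ι * ((1 + 2 * αU / (lev L (i + 1) : ℕ)) ^ ((d + 1) * L) - 1) + cR d L ι * (64 * (d * (L : ℝ) ^ 2 * p k (i + 1)))) ≤ E)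
    (hrate : ∀ k,
      sameBnd d L ι (Cst d a) ((1 + Fintype.card ι * (Real.exp ((((d + 1) * L : ℕ) : ℝ) * (2 * αU)) - 1)) * cR d L ι * Γ * Real.exp E)
          (1 + Fintype.card ι * (Real.exp ((((d + 1) * L : ℕ) : ℝ) * (2 * αU)) - 1) + (1 + Fintype.card ι * (Real.exp ((((d + 1) * L : ℕ) : ℝ) * (2 * αU)) - 1)) * cR d L ι * Γ * Real.exp E)
          ((1 + 2 * αU / (lev L (k + 1) : ℕ)) ^ ((d + 1) * L) - 1) (64 * (d * (L : ℝ) ^ 2 * p (k + 1) (k + 1))) (lev L k)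
        + crossBnd ι (Cst d a) (1 + Fintype.card ι * (Real.exp ((((d + 1) * L : ℕ) : ℝ) * (2 * αU)) - 1) + (1 + Fintype.card ι * (Real.exp ((((d + 1) * L : ℕ) : ℝ) * (2 * αU)) - 1)) * cR d L ι * Γ * Real.exp E)
          (∑ i ∈ range k, DeltaStep d L ι (2 * cU k (i + 1)) (64 * (d * (L : ℝ) ^ 2 * p k (i + 1))) (192 * ((d + 1) * L) * cU k (i + 1)) (2 * cU k i)) (∏ i ∈ range k, (1 + epsStep d L ι ((1 + 2 * αU / (lev L (i + 1) : ℕ)) ^ ((d + 1) * L) - 1) (64 * (d * (L : ℝ) ^ 2 * p (k + 1) (i + 1))))) (consBal d L (fun i => 2 * cU k i) k)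
        ≤ Cr * ρ ^ k)
    {P₄ : (k : ℕ) → Matrix (idx L M k × ι) (idx L M k × ι) ℂ} {κ₄ C₄ : ℝ}
    (hP₄ : PerturbationLaws (fun k => calDalev L M a ha k ⊗ₖ (1 : Matrix ι ι ℂ)) P₄ (fun k => JpcT L M k ⊗ₖ (1 : Matrix ι ι ℂ)) κ₄ (fun k => C₄ * ρ ^ k))
    (hsmall : kappaB ι d a αR βR C (kappaQ d a (a : ℂ) (Fintype.card ι * (Real.exp ((((d + 1) * L : ℕ) : ℝ) * (2 * αU)) - 1)
      + (1 + Fintype.card ι * (Real.exp ((((d + 1) * L : ℕ) : ℝ) * (2 * αU)) - 1)) * cR d L ι * Γ * Real.exp E)) κ₄ < 1) :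
    TowerLimitRate (fun k => Qlev L M k ⊗ₖ (1 : Matrix ι ι ℂ)) ((L : ℝ) ^ d)
      (fun k => (calDalev L M a ha k ⊗ₖ (1 : Matrix ι ι ℂ)
        + tierBPert L M R (avgPertFull L M a (fun k => TBal L M (adT L M hF (U k)) k) (fun k => Erem L M (adT L M hF (U k)) (remCoeffOf L M (fundT L M (U k)) c e (adT L M hF (U k))) k)) P₄ k)⁻¹)
      (Cpert (kappaB ι d a αR βR C (kappaQ d a (a : ℂ) (Fintype.card ι * (Real.exp ((((d + 1) * L : ℕ) : ℝ) * (2 * αU)) - 1)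
          + (1 + Fintype.card ι * (Real.exp ((((d + 1) * L : ℕ) : ℝ) * (2 * αU)) - 1)) * cR d L ι * Γ * Real.exp E)) κ₄) (2 * d * Cst d a) (CJ d a)
        (C2B ι d L a αR βR C
          (a * C2gram (Cst d a) 1 (Fintype.card ι * (Real.exp ((((d + 1) * L : ℕ) : ℝ) * (2 * αU)) - 1)
              + (1 + Fintype.card ι * (Real.exp ((((d + 1) * L : ℕ) : ℝ) * (2 * αU)) - 1)) * cR d L ι * Γ * Real.exp E) (2 * d * Cst d a) (CJ d a) (Cst d a)
            (Cst d a * Fintype.card ι * (thetaZero d L (2 * αU) (2 * σU) + (Real.exp ((((d + 1) * L : ℕ) : ℝ) * (2 * αU)) - 1)) + Cr)) C₄) 0 1) ρ   := by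
  have hα : (0 : ℝ) ≤ 2 * αU := by positivity
  have hWn : ∀ k i ν b, ‖adT L M hF (U k) i ν b‖ ≤ 1 := fun k i ν b => norm_adT_le_one L M hF (U k) i ν b
  have hWa : ∀ k i ν b, ‖adT L M hF (U k) i ν b - 1‖ ≤ 2 * αU / (lev L i : ℕ) := fun k i ν b => by
    rw [mul_div_assoc]; exact norm_adT_sub_one_le L M hF (U k) i ν b (hUa k i ν b)
  have hWc : ∀ k i ν b, i ≤ k → ‖adT L M hF (U (k + 1)) i ν b - adT L M hF (U k) i ν b‖ ≤ 2 * σU * θc ^ k / (lev L i : ℕ) := fun k i ν b hik => by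
    rw [mul_assoc, mul_div_assoc]; exact norm_adT_sub_adT_le L M hF (U (k + 1)) (U k) i ν b (hUc k i ν b hik)
  have hWd : ∀ k i ν b, ‖adT L M hF (U (k + 1)) (i + 1) ν b - adT L M hF (U k) (i + 1) ν b‖ ≤ 2 * cU k (i + 1) := fun k i ν b =>
    norm_adT_sub_adT_le L M hF (U (k + 1)) (U k) (i + 1) ν b (hUd k (i + 1) ν b)
  have hRd : ∀ k i (x : Tor (fine (lev L i) M)) (μ : Fin d), ‖adT L M hF (U (k + 1)) i μ (x, μ) - adT L M hF (U k) i μ (x, μ)‖ ≤ 2 * cU k i := fun k i x μ =>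
    norm_adT_sub_adT_le L M hF (U (k + 1)) (U k) i μ (x, μ) (hUd k i μ (x, μ))
  have hS : ∀ k i x r μ (s : Fin L), ‖(haveI := lev_neZero L i; Smain (lev L i) L M (adT L M hF (U k) (i + 1)) x r μ s) - 1‖ ≤ (1 + 2 * αU / (lev L (i + 1) : ℕ)) ^ ((d + 1) * L) - 1 :=
    fun k i x r μ s => by
      haveI := lev_neZero L i
      exact norm_Smain_sub_one_le (lev L i) L M (V := adT L M hF (U k) (i + 1)) (a := 2 * αU / (lev L (i + 1) : ℕ)) (by positivity) (fun ν b => hWa k (i + 1) ν b) x r μ s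
  have hT : ∀ k y (j : Fin d → Fin (lev L k)) μ (t : Fin (lev L k)), ‖TBal L M (adT L M hF (U (k + 1))) k y j μ t - TBal L M (adT L M hF (U k)) k y j μ t‖ ≤ consBal d L (fun i => 2 * cU k i) k :=
    fun k y j μ t => norm_prefix_sub_prefix_le L M (c := fun i => 2 * cU k i) (fun i => by have := hcU0 k i; positivity) (hWn k) (hWn (k + 1))
      (fun i ν b => norm_adT_sub_adT_le L M hF (U (k + 1)) (U k) i ν b (hUd k i ν b)) le_rfl y (fun ν => (j ν : ℕ)) μ t
  exact composed_full_averaging_rate_of_loops L M a ha hF.pos P hF.herm e hF.mem hF.orth hF.compl (fun Y hY X hX => lie_mem_of_stable P hF.herm hF.stable hY hX) hL hd hreg hC hNE3 (W := fun k => adT L M hF (U k)) (α := 2 * αU) (σ := 2 * σU)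
    hα (by positivity) hθ0 hθ1 hθρ hρ hρ1 hWn hWa hWc (U := fun k => fundT L M (U k)) (fun k i ν b => fundT_mem L M (U k) i ν b) hp0 hp hpL hYP
    (σ₁ := fun k i => (1 + 2 * αU / (lev L (i + 1) : ℕ)) ^ ((d + 1) * L) - 1) (cW := fun k i => 2 * cU k (i + 1)) (cU := fun k i => cU k (i + 1)) (δR := fun k i => 2 * cU k i)
    (θ := fun k => consBal d L (fun i => 2 * cU k i) k)
    (fun k i => sub_nonneg.mpr (one_le_pow₀ (le_add_of_nonneg_right (by positivity)))) (fun k i => by have := hcU0 k (i + 1); positivity)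
    (fun k i => hcU0 k (i + 1)) (fun k i => by have := hcU0 k i; positivity) (fun k => consBal_nonneg L (fun i => by have := hcU0 k i; positivity) k)
    hS hΓ hE hWd (fun k i ν b => hUd k (i + 1) ν b) hRd hT hrate hP₄ hsmall

end Summit.QuantumFields.BalabanUV.T4Continuum.NE2.ComposedRemainderGaugeTower

end
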